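import Literature.LinearAlgebra.Subspace.SpanPairCount
import HarnessLib

/-!
# Cones of three families of punctured lines: cardinality and the line lemma

Topic `LinearAlgebra/Subspace`.  For triples of vectors `(aᵢ, bᵢ, eᵢ)_{i<N}` in `F^m` over a finite
field `F` (`q = |F|`) consider the three "colour cones"
`𝒮 = {σ aᵢ − τ bᵢ}`, `𝒯 = {σ bᵢ − τ eᵢ}`, `𝒰 = {σ eᵢ − τ aᵢ}` (`σ, τ ∈ F^×`, all `i`) — the sets
`Aᵢ − Bᵢ`, `Bᵢ − Cᵢ`, `Cᵢ − Aᵢ` of the punctured lines `Aᵢ = F^× aᵢ`, `Bᵢ = F^× bᵢ`, `Cᵢ = F^× eᵢ`.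

* `card_cone` — under independence of each triple and pairwise disjointness, `|𝒮| = N (q − 1)²`;
* `cover_of_sixScalar` — the LINE LEMMA: under independence and the six-scalar zero-sum property
  (= the simultaneous triple product property of the punctured-line family, see
  `Literature/Computability/AlgebraicComplexity/STPPLineFamilies.lean`), every plane through the
  origin has `≤ q − 1` vectors of `𝒮`, or `≤ q − 1` of `𝒯`, or `≤ 3(q − 1)` of `𝒰` — exactly the
  cover hypothesis of `Literature.LinearAlgebra.Subspace.card_mul_lt_of_cover`
  (`SpanPairCover.lean`).

Statements take the cones as finsets characterised by membership (no definition, no decidability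
in statements).  Written for the matrix-multiplication summit (route `AlgebraicSTPPDichotomy`);
elementary linear algebra, proved here in full.
-/

open Submodule Finset

namespace Literature.LinearAlgebra.Subspace

variable {F : Type*} [Field F] [Fintype F] {m N : ℕ}

/-- **The cone of one colour has exactly `N (q − 1)²` vectors.**  If the triples `(aᵢ, bᵢ, eᵢ)` are
linearly independent (`hind`) and the punctured planes `{σ aᵢ − τ bᵢ : σ, τ ≠ 0}` are pairwise
disjoint (`hdisj`), then `|{σ aᵢ − τ bᵢ : i < N, σ, τ ≠ 0}| = N (q − 1)²`. [folklore] -/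
theorem card_cone (a b e : Fin N → (Fin m → F))
    (hdisj : ∀ (i k : Fin N) (σ τ σ' τ' : F), σ ≠ 0 → τ ≠ 0 → σ' ≠ 0 → τ' ≠ 0 →
      σ • a i - τ • b i = σ' • a k - τ' • b k → i = k)
    (hind : ∀ (i : Fin N) (α β γ : F), α • a i + β • b i + γ • e i = 0 → α = 0 ∧ β = 0 ∧ γ = 0)
    (ES : Finset (Fin m → F))
    (hES : ∀ x, x ∈ ES ↔ ∃ i, ∃ σ τ : F, σ ≠ 0 ∧ τ ≠ 0 ∧ x = σ • a i - τ • b i) :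
    ES.card = N * (Fintype.card F - 1) ^ 2 := by
  classical
  set f : Fin N → F × F → (Fin m → F) := fun i στ => στ.1 • a i - στ.2 • b i with hf
  set P : Finset (F × F) := (univ.filter (fun σ : F => σ ≠ 0)) ×ˢ (univ.filter (fun τ : F => τ ≠ 0))
    with hP
  have hPcard : P.card = (Fintype.card F - 1) ^ 2 := by
    rw [hP, card_product]
    have : (univ.filter (fun σ : F => σ ≠ 0)).card = Fintype.card F - 1 := by
      rw [filter_ne' univ (0 : F), card_erase_of_mem (mem_univ _), card_univ]
    rw [this, sq]
  have hESe : ES = (univ : Finset (Fin N)).biUnion (fun i => P.image (f i)) := by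
    ext x
    simp only [hES, mem_biUnion, mem_univ, true_and, mem_image, hP, mem_product, mem_filter,
      Prod.exists, hf]
    constructor
    · rintro ⟨i, σ, τ, hσ, hτ, rfl⟩
      exact ⟨i, σ, τ, ⟨hσ, hτ⟩, rfl⟩
    · rintro ⟨i, σ, τ, ⟨hσ, hτ⟩, rfl⟩
      exact ⟨i, σ, τ, hσ, hτ, rfl⟩
  have hinj : ∀ i, Set.InjOn (f i) P := by
    rintro i ⟨σ, τ⟩ hστ ⟨σ', τ'⟩ hστ' h
    simp only [hf] at h
    have := hind i (σ - σ') (τ' - τ) 0 (by linear_combination (norm := module) h)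
    exact Prod.ext (sub_eq_zero.1 this.1) (sub_eq_zero.1 this.2.1).symm
  rw [hESe, card_biUnion]
  · rw [sum_congr rfl (fun i _ => card_image_of_injOn (hinj i)), sum_const, card_univ,
      Fintype.card_fin, smul_eq_mul, hPcard]
  · intro i _ k _ hik
    rw [Function.onFun, disjoint_left]
    intro x hxi hxk
    rw [mem_image] at hxi hxk
    obtain ⟨⟨σ, τ⟩, hστ, rfl⟩ := hxi
    obtain ⟨⟨σ', τ'⟩, hστ', h⟩ := hxk
    simp only [hP, mem_product, mem_filter, mem_univ, true_and] at hστ hστ'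
    simp only [hf] at h
    exact hik (hdisj i k σ τ σ' τ' hστ.1 hστ.2 hστ'.1 hστ'.2 h.symm)


/-- **Line lemma for three families of punctured lines.**  Let `(aᵢ, bᵢ, eᵢ)_{i<N}` be triples of
vectors of `F^m`, each triple linearly independent (`hind`), with the six-scalar zero-sum property
(`hkey`): whenever `(σ aᵢ − τ bᵢ) + (σ' bⱼ − τ' eⱼ) + (σ'' e_k − τ'' a_k) = 0` with all six scalars
non-zero then `i = j = k` (this is the simultaneous triple product property of the punctured lines
`F^× aᵢ, F^× bᵢ, F^× eᵢ`).  Put `𝒮 = {σ aᵢ − τ bᵢ}`, `𝒯 = {σ bᵢ − τ eᵢ}`, `𝒰 = {σ eᵢ − τ aᵢ}`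
(`σ, τ ≠ 0`, all `i`).  Then every plane `L = span{v, w}` through the origin has at most `q − 1`
vectors of `𝒮`, or at most `q − 1` of `𝒯`, or at most `3(q − 1)` of `𝒰` (`q = |F|`).  Proof:
otherwise pick `x ∈ 𝒮 ∩ L`, `y ∈ 𝒯 ∩ L` independent; any `z ∈ 𝒰 ∩ L` off the lines of `x, y` is
`α x + β y` with `α β ≠ 0`, so `hkey` forces its index to be that of `x` (and of `y`); two
independent such `z` span `L`, putting `x` in `span{aᵢ, eᵢ}` and contradicting `hind`. (Elementary;
proved here, no published source.) [folklore] -/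
theorem cover_of_sixScalar [DecidableEq F] (a b e : Fin N → (Fin m → F))
    (hkey : ∀ (i j k : Fin N) (σ τ σ' τ' σ'' τ'' : F), σ ≠ 0 → τ ≠ 0 → σ' ≠ 0 → τ' ≠ 0 →
      σ'' ≠ 0 → τ'' ≠ 0 →
      (σ • a i - τ • b i) + (σ' • b j - τ' • e j) + (σ'' • e k - τ'' • a k) = 0 → i = j ∧ j = k)
    (hind : ∀ (i : Fin N) (α β γ : F), α • a i + β • b i + γ • e i = 0 → α = 0 ∧ β = 0 ∧ γ = 0)
    (ES ET EU : Finset (Fin m → F))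
    (hES : ∀ x, x ∈ ES ↔ ∃ i, ∃ σ τ : F, σ ≠ 0 ∧ τ ≠ 0 ∧ x = σ • a i - τ • b i)
    (hET : ∀ x, x ∈ ET ↔ ∃ i, ∃ σ τ : F, σ ≠ 0 ∧ τ ≠ 0 ∧ x = σ • b i - τ • e i)
    (hEU : ∀ x, x ∈ EU ↔ ∃ i, ∃ σ τ : F, σ ≠ 0 ∧ τ ≠ 0 ∧ x = σ • e i - τ • a i)
    (v w : Fin m → F) (L : Finset (Fin m → F)) (hv : v ≠ 0)
    (hw : w ∉ span F ({v} : Set (Fin m → F)))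
    (hL : ∀ x, x ∈ L ↔ x ∈ span F ({v, w} : Set (Fin m → F))) :
    (ES ∩ L).card + 1 ≤ Fintype.card F ∨ (ET ∩ L).card + 1 ≤ Fintype.card F ∨
      (EU ∩ L).card + 3 ≤ 3 * Fintype.card F := by
  classical
  set q := Fintype.card F with hq
  have h1q : 1 < q := Fintype.one_lt_card
  by_contra hcon
  push Not at hcon
  obtain ⟨hcS, hcT, hcU⟩ := hcon
  -- 0 is in none of the three sets
  have h0U : ∀ z ∈ EU, z ≠ 0 := by
    intro z hz h0
    obtain ⟨k, σ, τ, hσ, hτ, rfl⟩ := (hEU z).1 hz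
    have := hind k (-τ) 0 σ (by rw [← h0]; module)
    exact hσ this.2.2
  -- helper: a line minus the origin has q - 1 vectors; a subset of it avoiding 0 has ≤ q - 1
  have hline : ∀ (x : Fin m → F), x ≠ 0 → ∀ (S : Finset (Fin m → F)), (0 : Fin m → F) ∉ S →
      (∀ z ∈ S, z ∈ span F ({x} : Set (Fin m → F))) → S.card ≤ q - 1 := by
    intro x hx S h0 hS
    have hsub : S ⊆ (univ.filter (fun z : Fin m → F => z ∈ span F ({x} : Set _))).erase 0 := by
      intro z hz
      simp only [mem_erase, mem_filter, mem_univ, true_and]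
      exact ⟨fun h => h0 (h ▸ hz), hS z hz⟩
    refine (card_le_card hsub).trans ?_
    rw [card_erase_of_mem (by simp), card_eq_of_mem_iff_mem_span_singleton (F := F) hx _
      (fun z => by simp)]
  -- Step A: x ∈ ES ∩ L, y ∈ ET ∩ L with y ∉ span{x}
  obtain ⟨x, hx⟩ : (ES ∩ L).Nonempty := by
    rw [← card_pos]; omega
  rw [mem_inter] at hx
  obtain ⟨i, σ, τ, hσ, hτ, hxdef⟩ := (hES x).1 hx.1
  have hx0 : x ≠ 0 := by
    intro h0
    have := hind i σ (-τ) 0 (by rw [hxdef] at h0; rw [← h0]; module)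
    exact hσ this.1
  obtain ⟨y, hy, hyx⟩ : ∃ y ∈ ET ∩ L, y ∉ span F ({x} : Set (Fin m → F)) := by
    by_contra hall
    push Not at hall
    have h0T : (0 : Fin m → F) ∉ ET ∩ L := by
      intro h0
      obtain ⟨j, σ', τ', hσ', hτ', h0'⟩ := (hET 0).1 (mem_inter.1 h0).1
      have := hind j 0 σ' (-τ') (by rw [h0']; module)
      exact hσ' this.2.1
    have := hline x hx0 _ h0T hall
    omega
  rw [mem_inter] at hy
  obtain ⟨j, σ', τ', hσ', hτ', hydef⟩ := (hET y).1 hy.1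
  -- Step B: L is the span of x and y
  have hLxy : ∀ z, z ∈ L → z ∈ span F ({x, y} : Set (Fin m → F)) := by
    set Lxy : Finset (Fin m → F) := univ.filter (fun z => z ∈ span F ({x, y} : Set (Fin m → F)))
      with hLxy'
    have hsub : Lxy ⊆ L := subset_of_mem_span_pair ((hL x).1 hx.2) ((hL y).1 hy.2) L Lxy hL
      (fun z => by simp [hLxy'])
    have hcard : L.card ≤ Lxy.card := by
      rw [card_eq_sq_of_mem_iff_mem_span_pair (F := F) hv hw L hL,
        card_eq_sq_of_mem_iff_mem_span_pair (F := F) hx0 hyx Lxy (fun z => by simp [hLxy'])]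
    have heq := eq_of_subset_of_card_le hsub hcard
    intro z hz
    rw [← heq] at hz
    simpa [hLxy'] using hz
  -- Step D (stated before C): every z ∈ EU ∩ L off the lines of x and y forces i = j = k
  have hstepD : ∀ z ∈ EU ∩ L, z ∉ span F ({x} : Set (Fin m → F)) →
      z ∉ span F ({y} : Set (Fin m → F)) →
      ∀ (k : Fin N) (σ'' τ'' : F), σ'' ≠ 0 → τ'' ≠ 0 → z = σ'' • e k - τ'' • a k →
      i = j ∧ j = k := by
    intro z hz hzx hzy k σ'' τ'' hσ'' hτ'' hzdef
    have hz' := hLxy z (mem_inter.1 hz).2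
    rw [mem_span_pair] at hz'
    obtain ⟨α, β, hαβ⟩ := hz'
    have hα : α ≠ 0 := by
      rintro rfl
      apply hzy
      rw [← hαβ, zero_smul, zero_add]
      exact smul_mem _ _ (mem_span_singleton_self y)
    have hβ : β ≠ 0 := by
      rintro rfl
      apply hzx
      rw [← hαβ, zero_smul, add_zero]
      exact smul_mem _ _ (mem_span_singleton_self x)
    refine hkey i j k (-α * σ) (-α * τ) (-β * σ') (-β * τ') σ'' τ'' (mul_ne_zero (neg_ne_zero.2 hα) hσ)
      (mul_ne_zero (neg_ne_zero.2 hα) hτ) (mul_ne_zero (neg_ne_zero.2 hβ) hσ')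
      (mul_ne_zero (neg_ne_zero.2 hβ) hτ') hσ'' hτ'' ?_
    have : z = α • x + β • y := hαβ.symm
    rw [this, hxdef, hydef] at hzdef
    -- hzdef : α • (σ • a i - τ • b i) + β • (σ' • b j - τ' • e j) = σ'' • e k - τ'' • a k
    linear_combination (norm := module) (-1 : F) • hzdef
  -- Step C: at least q vectors of EU ∩ L off the two lines
  set Z : Finset (Fin m → F) := (EU ∩ L).filter (fun z => z ∉ span F ({x} : Set (Fin m → F)) ∧
    z ∉ span F ({y} : Set (Fin m → F))) with hZ
  have hy0 : y ≠ 0 := by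
    intro h0; apply hyx; rw [h0]; exact zero_mem _
  have hZcard : q ≤ Z.card := by
    have hsplit := card_filter_add_card_filter_not
      (s := EU ∩ L) (fun z => z ∉ span F ({x} : Set (Fin m → F)) ∧
        z ∉ span F ({y} : Set (Fin m → F)))
    have hrest : ((EU ∩ L).filter (fun z => ¬ (z ∉ span F ({x} : Set (Fin m → F)) ∧
        z ∉ span F ({y} : Set (Fin m → F))))).card ≤ (q - 1) + (q - 1) := by
      have hsub : (EU ∩ L).filter (fun z => ¬ (z ∉ span F ({x} : Set (Fin m → F)) ∧
          z ∉ span F ({y} : Set (Fin m → F)))) ⊆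
          (EU ∩ L).filter (fun z => z ∈ span F ({x} : Set (Fin m → F))) ∪
          (EU ∩ L).filter (fun z => z ∈ span F ({y} : Set (Fin m → F))) := by
        intro z hz
        simp only [mem_filter, mem_union, not_and_or, not_not] at hz ⊢
        tauto
      refine (card_le_card hsub).trans ((card_union_le _ _).trans (add_le_add ?_ ?_))
      · refine hline x hx0 _ (fun h => h0U 0 (mem_inter.1 (mem_filter.1 h).1).1 rfl) ?_
        intro z hz; exact (mem_filter.1 hz).2
      · refine hline y hy0 _ (fun h => h0U 0 (mem_inter.1 (mem_filter.1 h).1).1 rfl) ?_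
        intro z hz; exact (mem_filter.1 hz).2
    rw [hZ]
    omega
  -- Step E: two independent elements of Z
  obtain ⟨z₀, hz₀⟩ : Z.Nonempty := by rw [← card_pos]; omega
  have hz₀' := mem_filter.1 hz₀
  have hz₀0 : z₀ ≠ 0 := h0U z₀ (mem_inter.1 hz₀'.1).1
  obtain ⟨z₁, hz₁, hz₁₀⟩ : ∃ z₁ ∈ Z, z₁ ∉ span F ({z₀} : Set (Fin m → F)) := by
    by_contra hall
    push Not at hall
    have := hline z₀ hz₀0 Z (fun h => h0U 0 (mem_inter.1 (mem_filter.1 h).1).1 rfl) hall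
    omega
  have hz₁' := mem_filter.1 hz₁
  obtain ⟨k₀, σ₀, τ₀, hσ₀, hτ₀, hz₀def⟩ := (hEU z₀).1 (mem_inter.1 hz₀'.1).1
  obtain ⟨k₁, σ₁, τ₁, hσ₁, hτ₁, hz₁def⟩ := (hEU z₁).1 (mem_inter.1 hz₁'.1).1
  obtain ⟨hij, hjk₀⟩ := hstepD z₀ hz₀'.1 hz₀'.2.1 hz₀'.2.2 k₀ σ₀ τ₀ hσ₀ hτ₀ hz₀def
  obtain ⟨-, hjk₁⟩ := hstepD z₁ hz₁'.1 hz₁'.2.1 hz₁'.2.2 k₁ σ₁ τ₁ hσ₁ hτ₁ hz₁def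
  -- Step F: x lies in span{z₀, z₁} ⊆ span{a i, e i}: contradiction with independence
  have hxz : x ∈ span F ({z₀, z₁} : Set (Fin m → F)) := by
    set Lz : Finset (Fin m → F) := univ.filter (fun z => z ∈ span F ({z₀, z₁} : Set (Fin m → F)))
      with hLz'
    have hsub : Lz ⊆ L := subset_of_mem_span_pair ((hL z₀).1 (mem_inter.1 hz₀'.1).2)
      ((hL z₁).1 (mem_inter.1 hz₁'.1).2) L Lz hL (fun z => by simp [hLz'])
    have hcard : L.card ≤ Lz.card := by
      rw [card_eq_sq_of_mem_iff_mem_span_pair (F := F) hv hw L hL,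
        card_eq_sq_of_mem_iff_mem_span_pair (F := F) hz₀0 hz₁₀ Lz (fun z => by simp [hLz'])]
    have heq := eq_of_subset_of_card_le hsub hcard
    have := hx.2
    rw [← heq] at this
    simpa [hLz'] using this
  rw [mem_span_pair] at hxz
  obtain ⟨lam, mu, hlm⟩ := hxz
  subst hjk₀ hjk₁
  -- hlm : lam • z₀ + mu • z₁ = x with z₀ = σ₀ • e j - τ₀ • a j, z₁ = σ₁ • e j - τ₁ • a j, x = σ • a i - τ • b i, i = j
  subst hij
  rw [hz₀def, hz₁def, hxdef] at hlm
  have := hind i (σ + lam * τ₀ + mu * τ₁) (-τ) (-(lam * σ₀ + mu * σ₁))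
    (by linear_combination (norm := module) (-1 : F) • hlm)
  exact hτ (neg_eq_zero.1 this.2.1)


end Literature.LinearAlgebra.Subspace
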